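import Mathlib.Algebra.Module.ZLattice.Basic
import Mathlib.Analysis.MeanInequalities
import Mathlib.Analysis.MeanInequalitiesPow
import Mathlib.Analysis.Convex.SpecificFunctions.Basic
import Mathlib.Analysis.SpecialFunctions.Integrals.Basic
import Mathlib.MeasureTheory.Measure.Lebesgue.VolumeOfBalls
import Mathlib.MeasureTheory.Group.FundamentalDomain
import HarnessLib

/-!
# Rankin's bound for sums of linear forms (short lattice vectors in the `ℓ₁`-norm)

Topic `Literature/Algebra/EuclideanLattices`. Everything in this file is PROVED (no named facts).

For a full lattice `L = span_ℤ(b) ⊆ ℝ^N` and `N` real linear forms given by the coordinates, the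
minimum of `∑_t |v_t|` over `v ∈ L ∖ {0}` is bounded in terms of `det(L)^{1/N}`. Minkowski's
convex body theorem for the cross-polytope gives `δ_N ≤ (N!)^{1/N} ∼ N/e`; Blichfeldt (1936) and Rankin
(1948, *On sums of powers of linear forms III*) improved the constant. In the form printed by
Bright, *A new lower bound in the abc conjecture*, Canad. Math. Bull. 67 (2024), Lemma 2.3
(`lit read arxiv:2301.11056`, §2.3): for `x ∈ [1/2, 1]`,
`δ_n ≤ ((2-x)/(1-x))^{x-1} ((1+xn)/x · (xn)!)^{1/n} n^{1-x} / x!`, `x! = Γ(x+1)`,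
where `δ_n` is the least constant such that every full-rank lattice of dimension `n` has a
non-zero vector with `‖v‖₁ ≤ δ_n det(L)^{1/n}`; Corollary 2.4 there: `δ_n ≤ n/δ + O(log n)` with
`δ = max_x ((1-x)/(2-x))^{x-1} (e/x)^x x! ≈ 3.65931`.

## What is proved here (the main theorem is `Literature.Algebra.EuclideanLattices.Rankin.exists_ne_zero_l1_le`)

With `q = 1/x > 1`, `R^q := ((2q-1)/(q-1))^{q-1} N^{1-q}` and `0 < ρ < 1` a free parameter:
every full lattice `span_ℤ(b) ⊆ ℝ^N` has a non-zero vector with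
`∑_t |v_t| ≤ (2/(ρ R)) · (q |det b| / ((1-ρ^q) vol(B_q^N)))^{1/N}`,
`vol(B_q^N) = (2Γ(1/q+1))^N / Γ(N/q+1)` (Mathlib's `MeasureTheory.volume_sum_rpow_le`). Since
`(q/(1-ρ^q))^{1/N} → 1` for `ρ^q = 1 - 1/N`, the `N`-th root asymptotics of this bound are exactly
those of Bright's Lemma 2.3 / Corollary 2.4 (the two bounds differ by the factor
`((1+xN)·q/(x(1-ρ^q)))^{1/N} → 1`, irrelevant for Corollary 2.4).

## The argument (a reconstruction of Rankin's method; all steps elementary)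

* `rankin_one_dim`: for reals `a_1,…,a_k` and `q > 1`,
  `((2q-1)/(q-1))^{q-1} D^q / k^{2q-1} ≤ ∑ |a_i|^q`, `D = ½ ∑_{i,j} |a_i - a_j|`: write
  `D = ∑_i w_i a_i` with the signed rank weights `w_i = #{j : a_j < a_i} - #{j : a_j > a_i}`
  (`sum_weight_mul_eq`), apply Hölder, and bound the conjugate moment `∑ |w_i|^{q'}` by the
  tie-free configuration `∑_{r<k} |2r-k+1|^{q'}` (`sum_abs_weight_rpow_le`: tie classes average
  consecutive ranks, Jensen) and then by `k^{q'+1}/(q'+1)` (`sum_rankMoment_le`: two-step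
  induction with the Hermite–Hadamard inequality `(c+1)^{s+1} - (c-1)^{s+1} ≥ 2(s+1)c^s`).
* `weight_sum_le` / `weight_posPart_sum_le`: for points `y_1,…,y_k ∈ ℝ^N` pairwise at
  `ℓ₁`-distance `≥ 2`, summing the one-dimensional inequality over coordinates, the power mean
  over the `N` coordinates and Bernoulli's inequality give `∑_i (R^q - ‖y_i‖_q^q)₊ ≤ q R^q`.
* `lintegral_weight_le` (Blichfeldt's principle): if all non-zero lattice vectors have
  `ℓ₁`-norm `≥ λ`, the lattice periodisation of the weight `(R^q - ‖(2/λ) y‖_q^q)₊` is pointwise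
  `≤ q R^q` (the translates `(2/λ)(v + x)` are `2`-separated), so its integral is `≤ q R^q covol`
  (`ZSpan.isAddFundamentalDomain`, `IsAddFundamentalDomain.lintegral_eq_tsum''`).
* `covolume_ineq`: the weight is `≥ (1-ρ^q)R^q` on the `ℓ_q`-ball of radius `λρR/2`, whose volume
  Mathlib knows; `exists_ne_zero_l1_le` concludes by the finiteness of lattice points in balls.

## References

* C. Bright, *A new lower bound in the abc conjecture*, Canad. Math. Bull. 67 (2024) 369–378,
  Lemma 2.3 and Corollary 2.4 [Bright2024].
* R. A. Rankin, *On sums of powers of linear forms III*, Proc. Kon. Ned. Akad. Wetensch. 51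
  (1948) 846–853 [Rankin1948] (the source of Lemma 2.3 according to Bright; not consulted — the
  proof below is an independent reconstruction).
-/

noncomputable section

open Finset Real

namespace Literature.Algebra.EuclideanLattices.Rankin




variable {κ : Type*} [Fintype κ]

section counts
open scoped Classical

variable (a : κ → ℝ)

/-- The three rank counts of an index `i` (strictly below, strictly above, tied) add up to the
number of indices. [folklore] -/
theorem card_below_add_above_add_ties (i : κ) :
    #(univ.filter fun j => a j < a i) + #(univ.filter fun j => a i < a j)
      + #(univ.filter fun j => a j = a i) = Fintype.card κ := by
  have h1 : Disjoint (univ.filter fun j => a j < a i) (univ.filter fun j => a i < a j) := by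
    rw [Finset.disjoint_filter]; intro j _ h; exact not_lt.mpr h.le
  have h2 : Disjoint ((univ.filter fun j => a j < a i) ∪ (univ.filter fun j => a i < a j))
      (univ.filter fun j => a j = a i) := by
    rw [Finset.disjoint_left]
    intro j hj hj'
    simp only [mem_union, mem_filter, mem_univ, true_and] at hj hj'
    rcases hj with h | h
    · exact absurd hj' h.ne
    · exact absurd hj'.symm h.ne
  have h3 : ((univ.filter fun j => a j < a i) ∪ (univ.filter fun j => a i < a j))
      ∪ (univ.filter fun j => a j = a i) = univ := by
    ext j
    simp only [mem_union, mem_filter, mem_univ, true_and, iff_true]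
    rcases lt_trichotomy (a j) (a i) with h | h | h
    · exact Or.inl (Or.inl h)
    · exact Or.inr h
    · exact Or.inl (Or.inr h)
  rw [← card_union_of_disjoint h1, ← card_union_of_disjoint h2, h3, card_univ]

/-- `i` is tied with itself, so the tie count is positive. [folklore] -/
theorem card_ties_pos (i : κ) : 0 < #(univ.filter fun j => a j = a i) :=
  card_pos.mpr ⟨i, by simp⟩

/-- If `a i < a i'` then everything below or tied with `i` is strictly below `i'`; in particular
the rank windows `[ℓ_i, ℓ_i + t_i)` of differently valued indices are disjoint. [folklore] -/
theorem card_below_add_ties_le_of_lt {i i' : κ} (h : a i < a i') :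
    #(univ.filter fun j => a j < a i) + #(univ.filter fun j => a j = a i)
      ≤ #(univ.filter fun j => a j < a i') := by
  have hd : Disjoint (univ.filter fun j => a j < a i) (univ.filter fun j => a j = a i) := by
    rw [Finset.disjoint_filter]; intro j _ h1 h2; exact h1.ne h2
  rw [← card_union_of_disjoint hd]
  refine card_le_card ?_
  intro j hj
  simp only [mem_union, mem_filter, mem_univ, true_and] at hj ⊢
  rcases hj with hj | hj
  · exact hj.trans h
  · exact hj ▸ h

/-- The rank window `[ℓ_i, ℓ_i + t_i)` lies inside `[0, k)`. [folklore] -/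
theorem card_below_add_ties_le_card (i : κ) :
    #(univ.filter fun j => a j < a i) + #(univ.filter fun j => a j = a i) ≤ Fintype.card κ := by
  have := card_below_add_above_add_ties a i
  omega

/-- `∑_{u<t} (2(ℓ+u) - k + 1) = t (2ℓ + t - k)`. [folklore] -/
theorem sum_range_linear (ℓ k : ℝ) (t : ℕ) :
    ∑ u ∈ range t, (2 * (ℓ + u) - k + 1) = t * (2 * ℓ + t - k) := by
  induction t with
  | zero => simp
  | succ t ih =>
    rw [Finset.sum_range_succ, ih]
    push_cast
    ring

/-- The signed rank weight `w_i = #{below} - #{above}` times the tie count `t_i` is the sum of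
the `t_i` consecutive integers of fixed parity `2(ℓ_i+u) - k + 1`, `u < t_i` (`ℓ_i = #{below}`):
tie classes average the ranks they occupy. [folklore] -/
theorem weight_mul_ties_eq_sum (i : κ) :
    ((#(univ.filter fun j => a j < a i) : ℝ) - #(univ.filter fun j => a i < a j))
        * #(univ.filter fun j => a j = a i) =
      ∑ u ∈ range #(univ.filter fun j => a j = a i),
        (2 * ((#(univ.filter fun j => a j < a i) : ℝ) + u) - Fintype.card κ + 1) := by
  have hk := card_below_add_above_add_ties a i
  rw [sum_range_linear]
  have hk' : (Fintype.card κ : ℝ) = #(univ.filter fun j => a j < a i)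
      + #(univ.filter fun j => a i < a j) + #(univ.filter fun j => a j = a i) := by
    exact_mod_cast hk.symm
  rw [hk']
  ring

/-- Jensen step: `|w i|^s ≤ (1/t) ∑_{u<t} |2(ℓ+u) - k + 1|^s`. [folklore] -/
theorem abs_weight_rpow_le (i : κ) {s : ℝ} (hs : 1 ≤ s) :
    |((#(univ.filter fun j => a j < a i) : ℝ) - #(univ.filter fun j => a i < a j))| ^ s ≤
      (1 / #(univ.filter fun j => a j = a i)) * ∑ u ∈ range #(univ.filter fun j => a j = a i),
        |2 * ((#(univ.filter fun j => a j < a i) : ℝ) + u) - Fintype.card κ + 1| ^ s := by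
  set t := #(univ.filter fun j => a j = a i) with ht
  set ℓ := #(univ.filter fun j => a j < a i) with hℓ
  have htpos : (0 : ℝ) < t := by exact_mod_cast card_ties_pos a i
  have hw : ((ℓ : ℝ) - #(univ.filter fun j => a i < a j)) =
      ∑ u ∈ range t, (1 / (t : ℝ)) * (2 * ((ℓ : ℝ) + u) - Fintype.card κ + 1) := by
    rw [← Finset.mul_sum, ← weight_mul_ties_eq_sum a i]
    field_simp
    rfl
  have habs : |((ℓ : ℝ) - #(univ.filter fun j => a i < a j))| ≤
      ∑ u ∈ range t, (1 / (t : ℝ)) * |2 * ((ℓ : ℝ) + u) - Fintype.card κ + 1| := by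
    rw [hw]
    refine (abs_sum_le_sum_abs _ _).trans (le_of_eq ?_)
    refine Finset.sum_congr rfl fun u _ => ?_
    rw [abs_mul, abs_of_pos (by positivity : (0 : ℝ) < 1 / t)]
  have h0 : 0 ≤ |((ℓ : ℝ) - #(univ.filter fun j => a i < a j))| := abs_nonneg _
  calc |((ℓ : ℝ) - #(univ.filter fun j => a i < a j))| ^ s
      ≤ (∑ u ∈ range t, (1 / (t : ℝ)) * |2 * ((ℓ : ℝ) + u) - Fintype.card κ + 1|) ^ s :=
        Real.rpow_le_rpow h0 habs (by linarith)
    _ ≤ ∑ u ∈ range t, (1 / (t : ℝ)) * |2 * ((ℓ : ℝ) + u) - Fintype.card κ + 1| ^ s := by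
        refine Real.rpow_arith_mean_le_arith_mean_rpow (range t) _ _ (fun _ _ => by positivity)
          ?_ (fun _ _ => abs_nonneg _) hs
        rw [Finset.sum_const, Finset.card_range, nsmul_eq_mul]
        field_simp
    _ = (1 / (t : ℝ)) * ∑ u ∈ range t, |2 * ((ℓ : ℝ) + u) - Fintype.card κ + 1| ^ s := by
        rw [Finset.mul_sum]

/-- Reindexing the window `ℓ ≤ r < ℓ + t` inside `range k`. [folklore] -/
theorem sum_window_eq (i : κ) (ψ : ℕ → ℝ) :
    ∑ u ∈ range #(univ.filter fun j => a j = a i), ψ (#(univ.filter fun j => a j < a i) + u) =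
      ∑ r ∈ range (Fintype.card κ),
        if #(univ.filter fun j => a j < a i) ≤ r ∧
            r < #(univ.filter fun j => a j < a i) + #(univ.filter fun j => a j = a i)
          then ψ r else 0 := by
  set t := #(univ.filter fun j => a j = a i) with ht
  set ℓ := #(univ.filter fun j => a j < a i) with hℓ
  have hle : ℓ + t ≤ Fintype.card κ := card_below_add_ties_le_card a i
  rw [← Finset.sum_filter]
  have hI : (range (Fintype.card κ)).filter (fun r => ℓ ≤ r ∧ r < ℓ + t) = Ico ℓ (ℓ + t) := by
    ext r
    simp only [mem_filter, mem_range, mem_Ico]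
    constructor
    · rintro ⟨-, h1, h2⟩; exact ⟨h1, h2⟩
    · rintro ⟨h1, h2⟩; exact ⟨lt_of_lt_of_le h2 hle, h1, h2⟩
  rw [hI, Finset.sum_Ico_eq_sum_range, Nat.add_sub_cancel_left]
set_option maxHeartbeats 400000 in -- buildfix (bf3-g27): 160k/180k FAIL, 200k PASS at accept time; line-neutral budget line
/-- The windows of two indices with different values are disjoint; hence all indices whose
window contains a given `r` are tied, and their weights `1/t` sum to at most `1`. [folklore] -/
theorem sum_window_weights_le_one (r : ℕ) :
    ∑ i, (if #(univ.filter fun j => a j < a i) ≤ r ∧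
            r < #(univ.filter fun j => a j < a i) + #(univ.filter fun j => a j = a i)
          then (1 : ℝ) / #(univ.filter fun j => a j = a i) else 0) ≤ 1 := by
  rw [← Finset.sum_filter]
  set C := univ.filter fun i => #(univ.filter fun j => a j < a i) ≤ r ∧
      r < #(univ.filter fun j => a j < a i) + #(univ.filter fun j => a j = a i) with hC
  rcases C.eq_empty_or_nonempty with hCe | ⟨i₀, hi₀⟩
  · rw [hCe, Finset.sum_empty]; exact zero_le_one
  have hmem : ∀ i ∈ C, a i = a i₀ := by
    intro i hi
    rw [hC, mem_filter] at hi hi₀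
    by_contra hne
    rcases lt_or_gt_of_ne hne with hlt | hgt
    · have := card_below_add_ties_le_of_lt a hlt
      omega
    · have := card_below_add_ties_le_of_lt a hgt
      omega
  have ht : ∀ i ∈ C, #(univ.filter fun j => a j = a i) = #(univ.filter fun j => a j = a i₀) := by
    intro i hi; rw [hmem i hi]
  have hsub : C ⊆ univ.filter fun j => a j = a i₀ := by
    intro i hi
    simp only [mem_filter, mem_univ, true_and]
    exact hmem i hi
  have htpos : (0 : ℝ) < #(univ.filter fun j => a j = a i₀) := by exact_mod_cast card_ties_pos a i₀
  calc ∑ i ∈ C, (1 : ℝ) / #(univ.filter fun j => a j = a i)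
      = ∑ i ∈ C, (1 : ℝ) / #(univ.filter fun j => a j = a i₀) :=
        Finset.sum_congr rfl fun i hi => by rw [ht i hi]
    _ = #C * ((1 : ℝ) / #(univ.filter fun j => a j = a i₀)) := by
        rw [Finset.sum_const, nsmul_eq_mul]
    _ ≤ #(univ.filter fun j => a j = a i₀) * ((1 : ℝ) / #(univ.filter fun j => a j = a i₀)) := by
        gcongr
    _ = 1 := by field_simp

/-- **Tie classes average ranks**: the `s`-th moment of the signed rank weights is at most that
of the tie-free configuration `-(k-1), -(k-3), …, k-1`. [folklore] -/
theorem sum_abs_weight_rpow_le {s : ℝ} (hs : 1 ≤ s) :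
    ∑ i, |((#(univ.filter fun j => a j < a i) : ℝ) - #(univ.filter fun j => a i < a j))| ^ s ≤
      ∑ r ∈ range (Fintype.card κ), |2 * (r : ℝ) - Fintype.card κ + 1| ^ s := by
  set ψ : ℕ → ℝ := fun r => |2 * (r : ℝ) - Fintype.card κ + 1| ^ s with hψ
  have hψ0 : ∀ r, 0 ≤ ψ r := fun r => by positivity
  calc ∑ i, |((#(univ.filter fun j => a j < a i) : ℝ) - #(univ.filter fun j => a i < a j))| ^ s
      ≤ ∑ i, (1 / #(univ.filter fun j => a j = a i)) *
          ∑ u ∈ range #(univ.filter fun j => a j = a i),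
            ψ (#(univ.filter fun j => a j < a i) + u) := by
        refine Finset.sum_le_sum fun i _ => ?_
        have h := abs_weight_rpow_le a i hs
        simp only [hψ, Nat.cast_add]
        exact h
    _ = ∑ i, ∑ r ∈ range (Fintype.card κ),
          (if #(univ.filter fun j => a j < a i) ≤ r ∧
              r < #(univ.filter fun j => a j < a i) + #(univ.filter fun j => a j = a i)
            then (1 : ℝ) / #(univ.filter fun j => a j = a i) else 0) * ψ r := by
        refine Finset.sum_congr rfl fun i _ => ?_
        rw [sum_window_eq a i ψ, Finset.mul_sum]
        refine Finset.sum_congr rfl fun r _ => ?_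
        split_ifs <;> simp
    _ = ∑ r ∈ range (Fintype.card κ), (∑ i,
          (if #(univ.filter fun j => a j < a i) ≤ r ∧
              r < #(univ.filter fun j => a j < a i) + #(univ.filter fun j => a j = a i)
            then (1 : ℝ) / #(univ.filter fun j => a j = a i) else 0)) * ψ r := by
        rw [Finset.sum_comm]
        refine Finset.sum_congr rfl fun r _ => ?_
        rw [Finset.sum_mul]
    _ ≤ ∑ r ∈ range (Fintype.card κ), 1 * ψ r := by
        refine Finset.sum_le_sum fun r _ => ?_
        exact mul_le_mul_of_nonneg_right (sum_window_weights_le_one a r) (hψ0 r)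
    _ = _ := by simp [hψ]

end counts



/-! ### The moment of the tie-free rank configuration -/

/-- Hermite–Hadamard for the convex function `u ↦ u^s` (`s ≥ 1`) on `[c-1, c+1]`, `c ≥ 1`:
`(c+1)^{s+1} - (c-1)^{s+1} ≥ 2 (s+1) c^s`. [folklore] -/
theorem two_mul_rpow_le_rpow_succ_sub {c s : ℝ} (hc : 1 ≤ c) (hs : 1 ≤ s) :
    2 * (s + 1) * c ^ s ≤ (c + 1) ^ (s + 1) - (c - 1) ^ (s + 1) := by
  have hs0 : 0 < s := by linarith
  have hs1 : 0 < s + 1 := by linarith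
  have hcont : Continuous fun u : ℝ => u ^ s := Real.continuous_rpow_const hs0.le
  -- pointwise convexity
  have hpt : ∀ t ∈ Set.Icc (0 : ℝ) 1, 2 * c ^ s ≤ (c + t) ^ s + (c - t) ^ s := by
    intro t ht
    have h1 : 0 ≤ c + t := by linarith [ht.1]
    have h2 : 0 ≤ c - t := by linarith [ht.2]
    have hconv := (convexOn_rpow hs).2 (Set.mem_Ici.mpr h1) (Set.mem_Ici.mpr h2)
      (by norm_num : (0 : ℝ) ≤ 1 / 2) (by norm_num : (0 : ℝ) ≤ 1 / 2) (by norm_num)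
    simp only [smul_eq_mul] at hconv
    have : (1 / 2 : ℝ) * (c + t) + 1 / 2 * (c - t) = c := by ring
    rw [this] at hconv
    linarith
  -- integrate over [0, 1]
  have hint1 : ∫ t in (0 : ℝ)..1, (c + t) ^ s = ∫ u in c..(c + 1), u ^ s := by
    rw [intervalIntegral.integral_comp_add_left (fun u => u ^ s) c]
    simp
  have hint2 : ∫ t in (0 : ℝ)..1, (c - t) ^ s = ∫ u in (c - 1)..c, u ^ s := by
    rw [intervalIntegral.integral_comp_sub_left (fun u => u ^ s) c]
    simp
  have hII : ∀ a b : ℝ, IntervalIntegrable (fun u : ℝ => u ^ s) MeasureTheory.volume a b :=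
    fun a b => hcont.intervalIntegrable a b
  have hadj : (∫ u in (c - 1)..c, u ^ s) + ∫ u in c..(c + 1), u ^ s
      = ∫ u in (c - 1)..(c + 1), u ^ s :=
    intervalIntegral.integral_add_adjacent_intervals (hII _ _) (hII _ _)
  have hrpow : ∫ u in (c - 1)..(c + 1), u ^ s = ((c + 1) ^ (s + 1) - (c - 1) ^ (s + 1)) / (s + 1) :=
    integral_rpow (Or.inl (by linarith))
  have hmono : ∫ t in (0 : ℝ)..1, (2 * c ^ s) ≤ ∫ t in (0 : ℝ)..1, ((c + t) ^ s + (c - t) ^ s) := by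
    refine intervalIntegral.integral_mono_on zero_le_one (by simp) ?_ hpt
    exact ((hcont.comp (continuous_const_add c)).add
      (hcont.comp (continuous_sub_left c))).intervalIntegrable _ _
  have hconst : ∫ t in (0 : ℝ)..1, (2 * c ^ s) = 2 * c ^ s := by simp
  have hsum : ∫ t in (0 : ℝ)..1, ((c + t) ^ s + (c - t) ^ s)
      = ((c + 1) ^ (s + 1) - (c - 1) ^ (s + 1)) / (s + 1) := by
    have hi1 : IntervalIntegrable (fun t : ℝ => (c + t) ^ s) MeasureTheory.volume 0 1 :=
      (hcont.comp (continuous_const_add c)).intervalIntegrable _ _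
    have hi2 : IntervalIntegrable (fun t : ℝ => (c - t) ^ s) MeasureTheory.volume 0 1 :=
      (hcont.comp (continuous_sub_left c)).intervalIntegrable _ _
    rw [intervalIntegral.integral_add hi1 hi2, hint1, hint2, add_comm, hadj, hrpow]
  rw [hconst, hsum, le_div_iff₀ hs1] at hmono
  linarith

/-- The recursion `S(k+2) = S(k) + 2 (k+1)^s` for `S(k) = ∑_{r<k} |2r - k + 1|^s`. [folklore] -/
theorem sum_rankMoment_succ_succ (k : ℕ) (s : ℝ) :
    ∑ r ∈ range (k + 2), |2 * (r : ℝ) - (k + 2 : ℕ) + 1| ^ s =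
      (∑ r ∈ range k, |2 * (r : ℝ) - k + 1| ^ s) + 2 * ((k : ℝ) + 1) ^ s := by
  rw [Finset.sum_range_succ, Finset.sum_range_succ']
  have h1 : |2 * ((k + 1 : ℕ) : ℝ) - (k + 2 : ℕ) + 1| = (k : ℝ) + 1 := by
    push_cast
    rw [abs_of_nonneg] <;> ring_nf
    positivity
  have h2 : |2 * ((0 : ℕ) : ℝ) - (k + 2 : ℕ) + 1| = (k : ℝ) + 1 := by
    push_cast
    rw [show (2 : ℝ) * 0 - (k + 2) + 1 = -((k : ℝ) + 1) by ring, abs_neg, abs_of_nonneg]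
    positivity
  have h3 : ∀ r : ℕ, |2 * ((r + 1 : ℕ) : ℝ) - (k + 2 : ℕ) + 1| = |2 * (r : ℝ) - k + 1| := by
    intro r; push_cast; ring_nf
  simp only [h1, h2, h3]
  ring

/-- **Moment bound**: `∑_{r<k} |2r - k + 1|^s ≤ k^{s+1}/(s+1)` for `s ≥ 1`. [folklore] -/
theorem sum_rankMoment_le (k : ℕ) {s : ℝ} (hs : 1 ≤ s) :
    ∑ r ∈ range k, |2 * (r : ℝ) - k + 1| ^ s ≤ (k : ℝ) ^ (s + 1) / (s + 1) := by
  have hs1 : 0 < s + 1 := by linarith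
  induction k using Nat.twoStepInduction with
  | zero => simp [Real.zero_rpow hs1.ne']
  | one =>
    simp only [Finset.sum_range_one, Nat.cast_zero, mul_zero, Nat.cast_one, zero_sub,
      neg_add_cancel, abs_zero, Real.zero_rpow (by linarith : s ≠ 0), Real.one_rpow]
    positivity
  | more k ih _ =>
    rw [sum_rankMoment_succ_succ]
    have hkey := two_mul_rpow_le_rpow_succ_sub (c := (k : ℝ) + 1) (s := s)
      (by simp) hs
    have e1 : ((k : ℝ) + 1 + 1) = ((k + 2 : ℕ) : ℝ) := by push_cast; ring
    have e2 : ((k : ℝ) + 1 - 1) = (k : ℝ) := by ring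
    rw [e1, e2] at hkey
    rw [le_div_iff₀ hs1] at ih ⊢
    nlinarith [ih, hkey]



variable {κ : Type*} [Fintype κ]

section ident
open scoped Classical
variable (a : κ → ℝ)

/-- `∑_i a_i (#{below i} - #{above i}) = ½ ∑_{i,j} |a_i - a_j|`. [folklore] -/
theorem sum_weight_mul_eq (a : κ → ℝ) :
    ∑ i, ((#(univ.filter fun j => a j < a i) : ℝ) - #(univ.filter fun j => a i < a j)) * a i =
      (1 / 2) * ∑ i, ∑ j, |a i - a j| := by
  set σ : κ → κ → ℝ := fun i j => (if a j < a i then 1 else 0) - (if a i < a j then 1 else 0)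
    with hσ
  have hw : ∀ i, ((#(univ.filter fun j => a j < a i) : ℝ) - #(univ.filter fun j => a i < a j))
      = ∑ j, σ i j := by
    intro i
    rw [hσ]
    simp only [Finset.sum_sub_distrib, Finset.natCast_card_filter]
  have hanti : ∀ i j, σ j i = - σ i j := by
    intro i j
    simp only [hσ]
    split_ifs <;> norm_num
  have habs : ∀ i j, (a i - a j) * σ i j = |a i - a j| := by
    intro i j
    simp only [hσ]
    rcases lt_trichotomy (a i) (a j) with h | h | h
    · rw [if_neg (not_lt.mpr h.le), if_pos h, abs_of_neg (sub_neg.mpr h)]; ring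
    · rw [h]; simp
    · rw [if_pos h, if_neg (not_lt.mpr h.le), abs_of_pos (sub_pos.mpr h)]; ring
  set T := ∑ i, ∑ j, a i * σ i j with hT
  have h1 : ∑ i, ((#(univ.filter fun j => a j < a i) : ℝ) - #(univ.filter fun j => a i < a j)) * a i
      = T := by
    rw [hT]
    refine Finset.sum_congr rfl fun i _ => ?_
    rw [hw i, Finset.sum_mul]
    refine Finset.sum_congr rfl fun j _ => by ring
  have h2 : T = ∑ i, ∑ j, (- (a j * σ i j)) := by
    rw [hT, Finset.sum_comm]
    refine Finset.sum_congr rfl fun i _ => Finset.sum_congr rfl fun j _ => ?_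
    rw [hanti j i]; ring
  have h3 : 2 * T = ∑ i, ∑ j, |a i - a j| := by
    rw [two_mul]
    nth_rewrite 2 [h2]
    rw [hT, ← Finset.sum_add_distrib]
    refine Finset.sum_congr rfl fun i _ => ?_
    rw [← Finset.sum_add_distrib]
    refine Finset.sum_congr rfl fun j _ => ?_
    rw [← habs i j]; ring
  rw [h1, ← h3]; ring

end ident


/-! ### The one-dimensional inequality (Hölder) -/

section onedim
open scoped Classical

/-- **Rankin's one-dimensional inequality.** For reals `a_i` (`i` in a finite index type of
cardinality `k`) and `q > 1`,
`((2q-1)/(q-1))^{q-1} · (½ ∑_{i,j} |a_i - a_j|)^q / k^{2q-1} ≤ ∑_i |a_i|^q`.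
(Hölder with the signed rank weights, whose conjugate moment is at most `k^{q'+1}/(q'+1)`.)
[folklore] -/
theorem rankin_one_dim (a : κ → ℝ) {q : ℝ} (hq : 1 < q) :
    ((2 * q - 1) / (q - 1)) ^ (q - 1) * ((1 / 2) * ∑ i, ∑ j, |a i - a j|) ^ q
        / (Fintype.card κ : ℝ) ^ (2 * q - 1) ≤ ∑ i, |a i| ^ q := by
  set k := Fintype.card κ with hk
  have hA0 : 0 ≤ ∑ i, |a i| ^ q := Finset.sum_nonneg fun i _ => by positivity
  rcases Nat.eq_zero_or_pos k with hk0 | hkpos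
  · rw [hk0, Nat.cast_zero, Real.zero_rpow (by linarith), div_zero]
    exact hA0
  have hq1 : 0 < q - 1 := by linarith
  have hq0 : 0 < q := by linarith
  set q' := q / (q - 1) with hq'
  have hq'1 : 1 < q' := by rw [hq', lt_div_iff₀ hq1]; linarith
  have hpq : q'.HolderConjugate q := by
    rw [Real.holderConjugate_iff]
    refine ⟨hq'1, ?_⟩
    rw [hq']; field_simp; ring
  set w : κ → ℝ := fun i =>
    ((#(univ.filter fun j => a j < a i) : ℝ) - #(univ.filter fun j => a i < a j)) with hw
  set D := (1 / 2) * ∑ i, ∑ j, |a i - a j| with hD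
  have hD0 : 0 ≤ D := by
    rw [hD]; refine mul_nonneg (by norm_num) (Finset.sum_nonneg fun i _ =>
      Finset.sum_nonneg fun j _ => abs_nonneg _)
  have hDw : D = ∑ i, w i * a i := by rw [hD, ← sum_weight_mul_eq a]
  -- Hölder
  have hH : D ≤ (∑ i, |w i| ^ q') ^ (1 / q') * (∑ i, |a i| ^ q) ^ (1 / q) := by
    rw [hDw]; exact Real.inner_le_Lp_mul_Lq univ w a hpq
  -- moment bound
  set W₀ := (k : ℝ) ^ (q' + 1) / (q' + 1) with hW₀
  have hkpos' : (0 : ℝ) < k := by exact_mod_cast hkpos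
  have hW₀pos : 0 < W₀ := by rw [hW₀]; positivity
  have hW : ∑ i, |w i| ^ q' ≤ W₀ :=
    (sum_abs_weight_rpow_le a hq'1.le).trans (sum_rankMoment_le k hq'1.le)
  have hH' : D ≤ W₀ ^ (1 / q') * (∑ i, |a i| ^ q) ^ (1 / q) := by
    refine hH.trans (mul_le_mul_of_nonneg_right ?_ (by positivity))
    exact Real.rpow_le_rpow (Finset.sum_nonneg fun i _ => by positivity) hW (by positivity)
  -- raise to the power q
  have hpow : D ^ q ≤ W₀ ^ (q - 1) * ∑ i, |a i| ^ q := by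
    have h1 := Real.rpow_le_rpow hD0 hH' hq0.le
    have h2 : (W₀ ^ (1 / q') * (∑ i, |a i| ^ q) ^ (1 / q)) ^ q = W₀ ^ (q - 1) * ∑ i, |a i| ^ q := by
      rw [Real.mul_rpow (by positivity) (by positivity), ← Real.rpow_mul hW₀pos.le,
        ← Real.rpow_mul hA0, one_div_mul_cancel hq0.ne', Real.rpow_one]
      have e : 1 / q' * q = q - 1 := by rw [hq']; field_simp
      rw [e]
    rwa [h2] at h1
  -- rewrite the constant
  have hW₀pow : W₀ ^ (q - 1) = (k : ℝ) ^ (2 * q - 1) / ((2 * q - 1) / (q - 1)) ^ (q - 1) := by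
    rw [hW₀, Real.div_rpow (by positivity) (by positivity), ← Real.rpow_mul hkpos'.le]
    have e1 : (q' + 1) * (q - 1) = 2 * q - 1 := by rw [hq']; field_simp; ring
    have e2 : q' + 1 = (2 * q - 1) / (q - 1) := by rw [hq']; field_simp; ring
    rw [e1, e2]
  have hc0 : 0 < ((2 * q - 1) / (q - 1)) ^ (q - 1) := by
    apply Real.rpow_pos_of_pos; apply div_pos <;> linarith
  have hkq : 0 < (k : ℝ) ^ (2 * q - 1) := by positivity
  rw [hW₀pow] at hpow
  rw [div_le_iff₀ hkq]
  calc ((2 * q - 1) / (q - 1)) ^ (q - 1) * D ^ q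
      ≤ ((2 * q - 1) / (q - 1)) ^ (q - 1) *
          ((k : ℝ) ^ (2 * q - 1) / ((2 * q - 1) / (q - 1)) ^ (q - 1) * ∑ i, |a i| ^ q) :=
        mul_le_mul_of_nonneg_left hpow hc0.le
    _ = (∑ i, |a i| ^ q) * (k : ℝ) ^ (2 * q - 1) := by
        field_simp

end onedim


/-! ### The weight inequality for `ℓ₁`-separated point sets -/

section weight

variable {ι : Type*} [Fintype ι]

/-- Sum over ordered pairs of an `ℓ₁`-`2`-separated family is at least `2 k (k-1)`. [folklore] -/
theorem sum_sum_l1Dist_ge {κ : Type*} [Fintype κ] [DecidableEq κ] (y : κ → ι → ℝ)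
    (hsep : ∀ i j, i ≠ j → 2 ≤ ∑ t, |y i t - y j t|) :
    2 * (Fintype.card κ : ℝ) * (Fintype.card κ - 1) ≤ ∑ i, ∑ j, ∑ t, |y i t - y j t| := by
  have h : ∀ i, 2 * ((Fintype.card κ : ℝ) - 1) ≤ ∑ j, ∑ t, |y i t - y j t| := by
    intro i
    have h1 : ∑ j ∈ univ.erase i, (2 : ℝ) ≤ ∑ j ∈ univ.erase i, ∑ t, |y i t - y j t| :=
      Finset.sum_le_sum fun j hj => hsep i j (Finset.ne_of_mem_erase hj).symm
    rw [Finset.sum_const, Finset.card_erase_of_mem (mem_univ i), card_univ, nsmul_eq_mul,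
      Nat.cast_sub (Fintype.card_pos_iff.mpr ⟨i⟩), Nat.cast_one] at h1
    refine (le_of_eq (by ring)).trans (h1.trans ?_)
    exact Finset.sum_le_univ_sum_of_nonneg fun j => Finset.sum_nonneg fun t _ => abs_nonneg _
  calc 2 * (Fintype.card κ : ℝ) * (Fintype.card κ - 1) = ∑ i : κ, 2 * ((Fintype.card κ : ℝ) - 1) := by
        rw [Finset.sum_const, card_univ, nsmul_eq_mul]; ring
    _ ≤ _ := Finset.sum_le_sum fun i _ => h i

/-- **Rankin's weight inequality.** If the points `y_i ∈ ℝ^N` (`N ≥ 1`) are pairwise at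
`ℓ₁`-distance at least `2`, then `∑_i (R^q - ∑_t |y_{i,t}|^q) ≤ q R^q`, where
`R^q = ((2q-1)/(q-1))^{q-1} N^{1-q}`, `q > 1`. [folklore] -/
theorem weight_sum_le {κ : Type*} [Fintype κ] (y : κ → ι → ℝ) {q : ℝ} (hq : 1 < q)
    (hN : 0 < Fintype.card ι) (hsep : ∀ i j, i ≠ j → 2 ≤ ∑ t, |y i t - y j t|) :
    ∑ i, (((2 * q - 1) / (q - 1)) ^ (q - 1) * (Fintype.card ι : ℝ) ^ (1 - q) - ∑ t, |y i t| ^ q)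
      ≤ q * (((2 * q - 1) / (q - 1)) ^ (q - 1) * (Fintype.card ι : ℝ) ^ (1 - q)) := by
  classical
  set N := Fintype.card ι with hN'
  set k := Fintype.card κ with hk
  set c := ((2 * q - 1) / (q - 1)) ^ (q - 1) with hc
  have hq1 : 0 < q - 1 := by linarith
  have hq0 : 0 < q := by linarith
  have hcpos : 0 < c := by rw [hc]; apply Real.rpow_pos_of_pos; apply div_pos <;> linarith
  have hNpos : (0 : ℝ) < N := by exact_mod_cast hN
  set Rq := c * (N : ℝ) ^ (1 - q) with hRq
  have hRqpos : 0 < Rq := by rw [hRq]; positivity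
  rw [Finset.sum_sub_distrib, Finset.sum_const, card_univ, nsmul_eq_mul, ← hk]
  rcases Nat.eq_zero_or_pos k with hk0 | hkpos
  · have : IsEmpty κ := Fintype.card_eq_zero_iff.mp (hk ▸ hk0)
    simp only [hk0, Nat.cast_zero, zero_mul, Finset.univ_eq_empty, Finset.sum_empty, sub_zero]
    positivity
  have hkpos' : (0 : ℝ) < k := by exact_mod_cast hkpos
  -- the column sums D_t
  set D : ι → ℝ := fun t => (1 / 2) * ∑ i, ∑ j, |y i t - y j t| with hD
  have hD0 : ∀ t, 0 ≤ D t := fun t => by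
    rw [hD]; exact mul_nonneg (by norm_num) (Finset.sum_nonneg fun i _ =>
      Finset.sum_nonneg fun j _ => abs_nonneg _)
  -- step 1: one-dimensional inequality in each coordinate
  have h1 : ∑ t, c * D t ^ q / (k : ℝ) ^ (2 * q - 1) ≤ ∑ i, ∑ t, |y i t| ^ q := by
    rw [Finset.sum_comm]
    exact Finset.sum_le_sum fun t _ => rankin_one_dim (fun i => y i t) hq
  clear_value D
  -- step 2: power mean over the coordinates
  have h2 : (N : ℝ) ^ (1 - q) * (∑ t, D t) ^ q ≤ ∑ t, D t ^ q := by
    have hpm := Real.rpow_arith_mean_le_arith_mean_rpow univ (fun _ => 1 / (N : ℝ)) D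
      (fun _ _ => by positivity)
      (by rw [Finset.sum_const, card_univ, nsmul_eq_mul, ← hN']; field_simp)
      (fun t _ => hD0 t) hq.le
    rw [← Finset.mul_sum, ← Finset.mul_sum, Real.mul_rpow (by positivity)
      (Finset.sum_nonneg fun t _ => hD0 t)] at hpm
    have e : (N : ℝ) ^ (1 - q) = N * (1 / (N : ℝ)) ^ q := by
      rw [Real.rpow_sub hNpos, Real.rpow_one, Real.div_rpow zero_le_one hNpos.le, Real.one_rpow]
      ring
    rw [e, mul_assoc]
    calc (N : ℝ) * ((1 / (N : ℝ)) ^ q * (∑ t, D t) ^ q) ≤ N * ((1 / (N : ℝ)) * ∑ t, D t ^ q) :=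
          mul_le_mul_of_nonneg_left hpm hNpos.le
      _ = ∑ t, D t ^ q := by field_simp
  -- step 3: the total ℓ₁ separation
  have h3 : (k : ℝ) * (k - 1) ≤ ∑ t, D t := by
    have := sum_sum_l1Dist_ge y hsep
    rw [← hk] at this
    have e : ∑ t, D t = (1 / 2) * ∑ i, ∑ j, ∑ t, |y i t - y j t| := by
      rw [hD, ← Finset.mul_sum]
      congr 1
      rw [Finset.sum_comm]
      refine Finset.sum_congr rfl fun i _ => ?_
      rw [Finset.sum_comm]
    rw [e]
    linarith
  have hk1' : (1 : ℝ) ≤ k := by exact_mod_cast hkpos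
  have hk1 : (0 : ℝ) ≤ (k : ℝ) - 1 := by linarith
  have h3' : ((k : ℝ) * (k - 1)) ^ q ≤ (∑ t, D t) ^ q :=
    Real.rpow_le_rpow (mul_nonneg hkpos'.le hk1) h3 hq0.le
  -- step 4: Bernoulli
  have hkq : 0 < (k : ℝ) ^ (2 * q - 1) := by positivity
  have h4 : (k : ℝ) - q ≤ ((k : ℝ) * (k - 1)) ^ q / (k : ℝ) ^ (2 * q - 1) := by
    have hb := one_add_mul_self_le_rpow_one_add (s := -(1 / (k : ℝ)))
      (by rw [neg_le_neg_iff, div_le_one hkpos']; exact hk1') hq.le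
    have hb' : (k : ℝ) - q ≤ k * (1 - 1 / (k : ℝ)) ^ q := by
      calc (k : ℝ) - q = k * (1 + q * -(1 / (k : ℝ))) := by field_simp; ring
        _ ≤ k * (1 + -(1 / (k : ℝ))) ^ q := mul_le_mul_of_nonneg_left hb hkpos'.le
        _ = k * (1 - 1 / (k : ℝ)) ^ q := by rw [← sub_eq_add_neg]
    have e : ((k : ℝ) * (k - 1)) ^ q / (k : ℝ) ^ (2 * q - 1) = k * (1 - 1 / (k : ℝ)) ^ q := by
      have e1 : (1 : ℝ) - 1 / k = (k - 1) / k := by field_simp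
      rw [e1, Real.div_rpow hk1 hkpos'.le, Real.mul_rpow hkpos'.le hk1, div_eq_iff hkq.ne']
      have eA : (k : ℝ) ^ q * (k : ℝ) ^ q = k * (k : ℝ) ^ (2 * q - 1) := by
        have h1' : (k : ℝ) * (k : ℝ) ^ (2 * q - 1) = (k : ℝ) ^ (1 : ℝ) * (k : ℝ) ^ (2 * q - 1) := by
          rw [Real.rpow_one]
        rw [h1', ← Real.rpow_add hkpos', ← Real.rpow_add hkpos']
        ring_nf
      have hkq' : (k : ℝ) ^ q ≠ 0 := by positivity
      field_simp
      linear_combination ((k : ℝ) - 1) ^ q * eA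
    rw [e]
    exact hb'
  -- combine
  have hmain : Rq * ((k : ℝ) - q) ≤ ∑ i, ∑ t, |y i t| ^ q := by
    calc Rq * ((k : ℝ) - q) ≤ Rq * (((k : ℝ) * (k - 1)) ^ q / (k : ℝ) ^ (2 * q - 1)) :=
          mul_le_mul_of_nonneg_left h4 hRqpos.le
      _ = c * ((N : ℝ) ^ (1 - q) * ((k : ℝ) * (k - 1)) ^ q) / (k : ℝ) ^ (2 * q - 1) := by
          rw [hRq]; ring
      _ ≤ c * ((N : ℝ) ^ (1 - q) * (∑ t, D t) ^ q) / (k : ℝ) ^ (2 * q - 1) := by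
          gcongr
      _ ≤ c * (∑ t, D t ^ q) / (k : ℝ) ^ (2 * q - 1) := by gcongr
      _ = ∑ t, c * D t ^ q / (k : ℝ) ^ (2 * q - 1) := by
          rw [Finset.mul_sum, Finset.sum_div]
      _ ≤ _ := h1
  nlinarith [hmain]

/-- **Rankin's weight inequality, truncated form.** With `R^q = ((2q-1)/(q-1))^{q-1} N^{1-q}`,
for every family of points of `ℝ^N` pairwise at `ℓ₁`-distance `≥ 2`,
`∑_i max(0, R^q - ∑_t |y_{i,t}|^q) ≤ q R^q`. [folklore] -/
theorem weight_posPart_sum_le {κ : Type*} [Fintype κ] (y : κ → ι → ℝ) {q : ℝ} (hq : 1 < q)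
    (hN : 0 < Fintype.card ι) (hsep : ∀ i j, i ≠ j → 2 ≤ ∑ t, |y i t - y j t|) :
    ∑ i, max 0 (((2 * q - 1) / (q - 1)) ^ (q - 1) * (Fintype.card ι : ℝ) ^ (1 - q)
        - ∑ t, |y i t| ^ q)
      ≤ q * (((2 * q - 1) / (q - 1)) ^ (q - 1) * (Fintype.card ι : ℝ) ^ (1 - q)) := by
  classical
  set Rq := ((2 * q - 1) / (q - 1)) ^ (q - 1) * (Fintype.card ι : ℝ) ^ (1 - q) with hRq
  set g : κ → ℝ := fun i => Rq - ∑ t, |y i t| ^ q with hg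
  have h1 : ∑ i, max 0 (g i) = ∑ i ∈ univ.filter (fun i => 0 < g i), g i := by
    rw [Finset.sum_filter]
    refine Finset.sum_congr rfl fun i _ => ?_
    split_ifs with h
    · exact max_eq_right h.le
    · exact max_eq_left (not_lt.mp h)
  have h2 : ∑ i ∈ univ.filter (fun i => 0 < g i), g i = ∑ i : {i // 0 < g i}, g i := by
    apply Finset.sum_subtype
    simp
  change ∑ i, max 0 (g i) ≤ q * Rq
  rw [h1, h2]
  have := weight_sum_le (fun i : {i // 0 < g i} => y i) hq hN
    (fun i j hij => hsep i j (fun h => hij (Subtype.ext h)))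
  exact this

end weight


/-! ### Blichfeldt's principle on the lattice -/

section lattice

open MeasureTheory ENNReal Module

variable {ι : Type*} [Fintype ι]

/-- The Rankin weight `y ↦ max(0, R^q - ∑_t |s y_t|^q)` is continuous. [folklore] -/
theorem continuous_weight (Rq s : ℝ) {q : ℝ} (hq : 0 ≤ q) :
    Continuous fun y : ι → ℝ => max 0 (Rq - ∑ t, |s * y t| ^ q) := by
  refine continuous_const.max (continuous_const.sub ?_)
  refine continuous_finsetSum _ fun t _ => ?_
  exact (Real.continuous_rpow_const hq).comp
    ((continuous_const.mul (continuous_apply t)).abs)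

/-- **Blichfeldt's principle with Rankin's weight.** Let `L = span_ℤ(b)` be a full lattice in
`ℝ^N` all of whose non-zero vectors have `ℓ₁`-norm `≥ λ > 0`. Then the integral of the weight
`max(0, R^q - ∑_t |(2/λ) y_t|^q)` is at most `q R^q · covol(L)`: its lattice periodisation is
pointwise `≤ q R^q` by the weight inequality, since the translates `(2/λ)(v + x)`, `v ∈ L`, are
pairwise `ℓ₁`-`2`-separated. [folklore] -/
theorem lintegral_weight_le (b : Basis ι ℝ (ι → ℝ)) {q : ℝ} (hq : 1 < q)
    (hN : 0 < Fintype.card ι) {lam : ℝ} (hlam : 0 < lam)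
    (hmin : ∀ v ∈ Submodule.span ℤ (Set.range b), v ≠ 0 → lam ≤ ∑ t, |v t|) :
    ∫⁻ y : ι → ℝ, ENNReal.ofReal (max 0 (((2 * q - 1) / (q - 1)) ^ (q - 1)
        * (Fintype.card ι : ℝ) ^ (1 - q) - ∑ t, |(2 / lam) * y t| ^ q)) ≤
      ENNReal.ofReal (q * (((2 * q - 1) / (q - 1)) ^ (q - 1) * (Fintype.card ι : ℝ) ^ (1 - q)))
        * volume (ZSpan.fundamentalDomain b) := by
  classical
  set Rq := ((2 * q - 1) / (q - 1)) ^ (q - 1) * (Fintype.card ι : ℝ) ^ (1 - q) with hRq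
  set L := Submodule.span ℤ (Set.range b) with hL
  have hq0 : 0 < q := by linarith
  set w : (ι → ℝ) → ℝ := fun y => max 0 (Rq - ∑ t, |(2 / lam) * y t| ^ q) with hw
  have hwc : Continuous w := continuous_weight Rq (2 / lam) hq0.le
  have hw0 : ∀ y, 0 ≤ w y := fun y => le_max_left _ _
  set F : (ι → ℝ) → ℝ≥0∞ := fun y => ENNReal.ofReal (w y) with hF
  have hFm : Measurable F := ENNReal.measurable_ofReal.comp hwc.measurable
  have hfd := ZSpan.isAddFundamentalDomain b (volume : Measure (ι → ℝ))
  have i1 : MeasurableVAdd L (ι → ℝ) := (inferInstance : MeasurableVAdd L.toAddSubgroup (ι → ℝ))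
  have i2 : VAddInvariantMeasure L (ι → ℝ) volume :=
    (inferInstance : VAddInvariantMeasure L.toAddSubgroup (ι → ℝ) volume)
  change ∫⁻ y, F y ≤ ENNReal.ofReal (q * Rq) * volume (ZSpan.fundamentalDomain b)
  rw [hfd.lintegral_eq_tsum'' F]
  have hvadd : ∀ (g : L) (x : ι → ℝ), g +ᵥ x = (g : ι → ℝ) + x := fun g x => rfl
  -- swap sum and integral
  have hswap : ∑' g : L, ∫⁻ x in ZSpan.fundamentalDomain b, F (g +ᵥ x)
      = ∫⁻ x in ZSpan.fundamentalDomain b, ∑' g : L, F (g +ᵥ x) := by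
    rw [lintegral_tsum]
    intro g
    simp_rw [hvadd]
    exact (hFm.comp (measurable_const_add _)).aemeasurable
  rw [hswap]
  -- pointwise bound on the periodisation
  have hpt : ∀ x : ι → ℝ, ∑' g : L, F (g +ᵥ x) ≤ ENNReal.ofReal (q * Rq) := by
    intro x
    -- the support is finite
    set r₀ : ℝ := max 1 Rq with hr₀
    have hsupp : ∀ g : L, F (g +ᵥ x) ≠ 0 →
        (g : ι → ℝ) ∈ Metric.closedBall (-x) (lam / 2 * r₀) := by
      intro g hg
      rw [hvadd] at hg
      have hpos : 0 < w ((g : ι → ℝ) + x) := by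
        rw [hF] at hg
        simp only [ne_eq, ENNReal.ofReal_eq_zero, not_le] at hg
        exact hg
      have hlt : ∑ t, |(2 / lam) * ((g : ι → ℝ) + x) t| ^ q < Rq := by
        rw [hw] at hpos
        simp only [lt_max_iff, lt_self_iff_false, false_or, sub_pos] at hpos
        exact hpos
      rw [Metric.mem_closedBall, dist_eq_norm, sub_neg_eq_add,
        pi_norm_le_iff_of_nonneg (by positivity)]
      intro t
      have ht : |(2 / lam) * ((g : ι → ℝ) + x) t| ^ q < Rq :=
        lt_of_le_of_lt (Finset.single_le_sum (f := fun t => |(2 / lam) * ((g : ι → ℝ) + x) t| ^ q)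
          (fun t _ => by positivity) (Finset.mem_univ t)) hlt
      have hle : |(2 / lam) * ((g : ι → ℝ) + x) t| ≤ r₀ := by
        rcases le_or_gt (|(2 / lam) * ((g : ι → ℝ) + x) t|) 1 with h1 | h1
        · exact h1.trans (le_max_left _ _)
        · exact ((Real.self_le_rpow_of_one_le h1.le hq.le).trans ht.le).trans (le_max_right _ _)
      rw [abs_mul, abs_of_pos (by positivity : (0 : ℝ) < 2 / lam)] at hle
      rw [Real.norm_eq_abs]
      calc |((g : ι → ℝ) + x) t| = lam / 2 * (2 / lam * |((g : ι → ℝ) + x) t|) := by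
            field_simp
        _ ≤ lam / 2 * r₀ := by gcongr
    have hfin : {g : L | F (g +ᵥ x) ≠ 0}.Finite := by
      have h1 : (Metric.closedBall (-x) (lam / 2 * r₀) ∩ (L : Set (ι → ℝ))).Finite :=
        ZSpan.setFinite_inter b Metric.isBounded_closedBall
      have h2 : {g : L | F (g +ᵥ x) ≠ 0} ⊆
          ((↑) : L → ι → ℝ) ⁻¹' (Metric.closedBall (-x) (lam / 2 * r₀) ∩ (L : Set (ι → ℝ))) := by
        intro g hg
        exact ⟨hsupp g hg, g.2⟩
      refine Set.Finite.subset (Set.Finite.preimage ?_ h1) h2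
      exact Set.injOn_of_injective Subtype.val_injective
    set S := hfin.toFinset with hS
    have htsum : ∑' g : L, F (g +ᵥ x) = ∑ g ∈ S, F (g +ᵥ x) := by
      apply tsum_eq_sum
      intro g hg
      by_contra h
      exact hg (hfin.mem_toFinset.mpr h)
    rw [htsum]
    -- apply the weight inequality to the finite family `(2/λ)(g + x)`, `g ∈ S`
    have hfam := weight_posPart_sum_le (κ := S) (fun g t => (2 / lam) * (((g : L) : ι → ℝ) + x) t)
      hq hN ?_
    · rw [← hRq] at hfam
      calc ∑ g ∈ S, F (g +ᵥ x) = ∑ g : S, F ((g : L) +ᵥ x) := (Finset.sum_coe_sort S _).symm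
        _ = ENNReal.ofReal (∑ g : S, w (((g : L) : ι → ℝ) + x)) := by
            rw [ENNReal.ofReal_sum_of_nonneg (fun g _ => hw0 _)]
            rfl
        _ ≤ ENNReal.ofReal (q * Rq) := ENNReal.ofReal_le_ofReal hfam
    · -- separation
      intro g g' hne
      have hsub : (((g : L) : ι → ℝ) - ((g' : L) : ι → ℝ)) ∈ L := L.sub_mem g.1.2 g'.1.2
      have hne' : (((g : L) : ι → ℝ) - ((g' : L) : ι → ℝ)) ≠ 0 := by
        intro h
        apply hne
        rw [sub_eq_zero] at h
        exact Subtype.ext (Subtype.ext h)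
      have hm := hmin _ hsub hne'
      have e : ∀ t, |2 / lam * (((g : L) : ι → ℝ) + x) t - 2 / lam * (((g' : L) : ι → ℝ) + x) t|
          = 2 / lam * |(((g : L) : ι → ℝ) - ((g' : L) : ι → ℝ)) t| := by
        intro t
        rw [← mul_sub, abs_mul, abs_of_pos (by positivity : (0 : ℝ) < 2 / lam)]
        congr 1
        simp only [Pi.add_apply, Pi.sub_apply]
        ring_nf
      simp_rw [e]
      rw [← Finset.mul_sum]
      calc (2 : ℝ) = 2 / lam * lam := by field_simp
        _ ≤ 2 / lam * ∑ t, |(((g : L) : ι → ℝ) - ((g' : L) : ι → ℝ)) t| := by gcongr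
  calc ∫⁻ x in ZSpan.fundamentalDomain b, ∑' g : L, F (g +ᵥ x)
      ≤ ∫⁻ x in ZSpan.fundamentalDomain b, ENNReal.ofReal (q * Rq) :=
        lintegral_mono fun x => hpt x
    _ = ENNReal.ofReal (q * Rq) * volume (ZSpan.fundamentalDomain b) := setLIntegral_const _ _

end lattice


section bound

open MeasureTheory ENNReal Module

variable {ι : Type*} [Fintype ι]

/-- **Covolume inequality.** If every non-zero vector of `span_ℤ(b)` has `ℓ₁`-norm `≥ λ > 0`, then
for `q > 1`, `0 < ρ < 1`, `R^q = ((2q-1)/(q-1))^{q-1} N^{1-q}`: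
`(1 - ρ^q) (λ ρ R / 2)^N · vol(B_q) ≤ q |det b|`, `vol(B_q) = (2Γ(1/q+1))^N / Γ(N/q+1)` the
volume of the unit `ℓ_q`-ball (the weight is `≥ (1-ρ^q) R^q` on the `ℓ_q`-ball of radius
`λ ρ R/2`, and its integral is `≤ q R^q |det b|` by `lintegral_weight_le`). [folklore] -/
theorem covolume_ineq [DecidableEq ι] (b : Basis ι ℝ (ι → ℝ)) {q : ℝ} (hq : 1 < q)
    (hN : 0 < Fintype.card ι) {lam : ℝ} (hlam : 0 < lam)
    (hmin : ∀ v ∈ Submodule.span ℤ (Set.range b), v ≠ 0 → lam ≤ ∑ t, |v t|)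
    {ρ : ℝ} (hρ0 : 0 < ρ) (hρ1 : ρ < 1) :
    (1 - ρ ^ q) * (lam / 2 * ρ *
        (((2 * q - 1) / (q - 1)) ^ (q - 1) * (Fintype.card ι : ℝ) ^ (1 - q)) ^ (1 / q))
          ^ Fintype.card ι *
        ((2 * Real.Gamma (1 / q + 1)) ^ Fintype.card ι / Real.Gamma (Fintype.card ι / q + 1))
      ≤ q * |(Matrix.of b).det| := by
  haveI : Nonempty ι := Fintype.card_pos_iff.mp hN
  set N := Fintype.card ι with hN'
  set Rq := ((2 * q - 1) / (q - 1)) ^ (q - 1) * (N : ℝ) ^ (1 - q) with hRq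
  have hq0 : 0 < q := by linarith
  have hq1 : 0 < q - 1 := by linarith
  have hNpos : (0 : ℝ) < N := by exact_mod_cast hN
  have hRqpos : 0 < Rq := by
    rw [hRq]; refine _root_.mul_pos ?_ ?_
    · apply Real.rpow_pos_of_pos; apply div_pos <;> linarith
    · positivity
  set V₁ := (2 * Real.Gamma (1 / q + 1)) ^ N / Real.Gamma (N / q + 1) with hV₁
  have hV₁pos : 0 < V₁ := by
    rw [hV₁]
    apply div_pos
    · apply pow_pos; exact _root_.mul_pos two_pos (Real.Gamma_pos_of_pos (by positivity))
    · exact Real.Gamma_pos_of_pos (by positivity)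
  set r := lam / 2 * ρ * Rq ^ (1 / q) with hr
  have hrpos : 0 < r := by rw [hr]; positivity
  have hρq : ρ ^ q < 1 := Real.rpow_lt_one hρ0.le hρ1 hq0
  -- the weight and its integral bound
  set w : (ι → ℝ) → ℝ := fun y => max 0 (Rq - ∑ t, |(2 / lam) * y t| ^ q) with hw
  have hwc : Continuous w := continuous_weight Rq (2 / lam) hq0.le
  set F : (ι → ℝ) → ℝ≥0∞ := fun y => ENNReal.ofReal (w y) with hF
  have hFm : Measurable F := ENNReal.measurable_ofReal.comp hwc.measurable
  have hup : ∫⁻ y, F y ≤ ENNReal.ofReal (q * Rq) * volume (ZSpan.fundamentalDomain b) :=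
    lintegral_weight_le b hq hN hlam hmin
  rw [ZSpan.volume_fundamentalDomain] at hup
  -- the ball
  set B : Set (ι → ℝ) := {y | (∑ t, |y t| ^ q) ^ (1 / q) ≤ r} with hB
  have hvolB : volume B = (ENNReal.ofReal r) ^ N * ENNReal.ofReal V₁ := by
    rw [hB, MeasureTheory.volume_sum_rpow_le ι hq.le r]
  have hlow : ∀ y ∈ B, ENNReal.ofReal ((1 - ρ ^ q) * Rq) ≤ F y := by
    intro y hy
    rw [hB, Set.mem_setOf_eq] at hy
    have hs0 : 0 ≤ ∑ t, |y t| ^ q := Finset.sum_nonneg fun t _ => by positivity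
    have h1 : ∑ t, |y t| ^ q ≤ r ^ q := by
      have := Real.rpow_le_rpow (by positivity) hy hq0.le
      rwa [← Real.rpow_mul hs0, one_div_mul_cancel hq0.ne', Real.rpow_one] at this
    have h2 : r ^ q = (lam / 2 * ρ) ^ q * Rq := by
      rw [hr, Real.mul_rpow (by positivity) (by positivity), ← Real.rpow_mul hRqpos.le,
        one_div_mul_cancel hq0.ne', Real.rpow_one]
    have h3 : ∑ t, |(2 / lam) * y t| ^ q = (2 / lam) ^ q * ∑ t, |y t| ^ q := by
      rw [Finset.mul_sum]
      refine Finset.sum_congr rfl fun t _ => ?_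
      rw [abs_mul, abs_of_pos (by positivity : (0 : ℝ) < 2 / lam),
        Real.mul_rpow (by positivity) (abs_nonneg _)]
    have h4 : ∑ t, |(2 / lam) * y t| ^ q ≤ ρ ^ q * Rq := by
      rw [h3]
      calc (2 / lam) ^ q * ∑ t, |y t| ^ q ≤ (2 / lam) ^ q * ((lam / 2 * ρ) ^ q * Rq) := by
            rw [← h2]; exact mul_le_mul_of_nonneg_left h1 (by positivity)
        _ = ((2 / lam) * (lam / 2 * ρ)) ^ q * Rq := by
            rw [← mul_assoc, ← Real.mul_rpow (x := 2 / lam) (y := lam / 2 * ρ) (by positivity)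
              (by positivity)]
        _ = ρ ^ q * Rq := by congr 2; field_simp
    rw [hF]
    refine ENNReal.ofReal_le_ofReal ?_
    rw [hw]
    refine le_trans ?_ (le_max_right _ _)
    nlinarith
  have hdown : ENNReal.ofReal ((1 - ρ ^ q) * Rq) * volume B ≤ ∫⁻ y, F y := by
    calc ENNReal.ofReal ((1 - ρ ^ q) * Rq) * volume B
        = ∫⁻ y in B, ENNReal.ofReal ((1 - ρ ^ q) * Rq) := (setLIntegral_const _ _).symm
      _ ≤ ∫⁻ y in B, F y := setLIntegral_mono hFm hlow
      _ ≤ ∫⁻ y, F y := setLIntegral_le_lintegral _ _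
  have hchain := hdown.trans hup
  have h1ρ : 0 ≤ (1 - ρ ^ q) * Rq := mul_nonneg (by linarith) hRqpos.le
  rw [hvolB, ← ENNReal.ofReal_pow hrpos.le, ← ENNReal.ofReal_mul (p := r ^ N) (by positivity),
    ← ENNReal.ofReal_mul (p := (1 - ρ ^ q) * Rq) h1ρ,
    ← ENNReal.ofReal_mul (p := q * Rq) (by positivity),
    ENNReal.ofReal_le_ofReal_iff (by positivity)] at hchain
  -- cancel `Rq`
  have : (1 - ρ ^ q) * r ^ N * V₁ * Rq ≤ q * |(Matrix.of b).det| * Rq := by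
    have e1 : (1 - ρ ^ q) * r ^ N * V₁ * Rq = (1 - ρ ^ q) * Rq * (r ^ N * V₁) := by ring
    have e2 : q * |(Matrix.of b).det| * Rq = q * Rq * |(Matrix.of b).det| := by ring
    rw [e1, e2]; exact hchain
  exact le_of_mul_le_mul_right this hRqpos

/-- From the covolume inequality to a bound on `λ`. [folklore] -/
theorem lam_le_of_covolume_ineq {N : ℕ} (hN : 0 < N) {q lam ρ Rq V₁ D : ℝ}
    (hlam : 0 < lam) (hρ0 : 0 < ρ) (hρq : ρ ^ q < 1) (hRq : 0 < Rq) (hV₁ : 0 < V₁)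
    (h : (1 - ρ ^ q) * (lam / 2 * ρ * Rq ^ (1 / q)) ^ N * V₁ ≤ q * D) :
    lam ≤ 2 / (ρ * Rq ^ (1 / q)) * (q * D / ((1 - ρ ^ q) * V₁)) ^ (1 / (N : ℝ)) := by
  have h1ρ : 0 < 1 - ρ ^ q := by linarith
  set r := lam / 2 * ρ * Rq ^ (1 / q) with hr
  have hrpos : 0 < r := by rw [hr]; positivity
  have h1 : r ^ N ≤ q * D / ((1 - ρ ^ q) * V₁) := by
    rw [le_div_iff₀ (by positivity)]; nlinarith
  have h2 : r ≤ (q * D / ((1 - ρ ^ q) * V₁)) ^ (1 / (N : ℝ)) := by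
    have := Real.rpow_le_rpow (by positivity) h1 (by positivity : (0 : ℝ) ≤ 1 / N)
    rwa [one_div, ← Real.rpow_natCast, ← Real.rpow_mul hrpos.le,
      mul_inv_cancel₀ (by positivity : (N : ℝ) ≠ 0), Real.rpow_one, ← one_div] at this
  have hden : 0 < ρ * Rq ^ (1 / q) := by positivity
  calc lam = 2 / (ρ * Rq ^ (1 / q)) * r := by rw [hr]; field_simp
    _ ≤ _ := mul_le_mul_of_nonneg_left h2 (by positivity)

/-- **Rankin's theorem (1948), finite form.** For every full lattice `span_ℤ(b) ⊆ ℝ^N` (`N ≥ 1`),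
every `q > 1` and `0 < ρ < 1`, there is a non-zero lattice vector `v` with
`‖v‖₁ ≤ (2/(ρ R)) · (q |det b| / ((1-ρ^q) vol(B_q)))^{1/N}`, where
`R^q = ((2q-1)/(q-1))^{q-1} N^{1-q}` and `vol(B_q) = (2Γ(1/q+1))^N/Γ(N/q+1)`.
Taking `N`-th roots (`ρ → 1`) this is Bright's Lemma 2.3:
`δ_N ≤ ((2-x)/(1-x))^{x-1} ((1+xN)/x · (xN)!)^{1/N} N^{1-x}/x!` up to the factor
`((1+xN)/x)^{1/N} → 1`, `x = 1/q`. [cite: Bright2024, Lemma 2.3] -/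
theorem exists_ne_zero_l1_le [DecidableEq ι] (b : Basis ι ℝ (ι → ℝ)) {q : ℝ} (hq : 1 < q)
    (hN : 0 < Fintype.card ι) {ρ : ℝ} (hρ0 : 0 < ρ) (hρ1 : ρ < 1) :
    ∃ v ∈ Submodule.span ℤ (Set.range b), v ≠ 0 ∧
      ∑ t, |v t| ≤ 2 / (ρ * (((2 * q - 1) / (q - 1)) ^ (q - 1)
          * (Fintype.card ι : ℝ) ^ (1 - q)) ^ (1 / q)) *
        (q * |(Matrix.of b).det| / ((1 - ρ ^ q) *
          ((2 * Real.Gamma (1 / q + 1)) ^ Fintype.card ι / Real.Gamma (Fintype.card ι / q + 1))))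
          ^ (1 / (Fintype.card ι : ℝ)) := by
  set N := Fintype.card ι with hN'
  set Rq := ((2 * q - 1) / (q - 1)) ^ (q - 1) * (N : ℝ) ^ (1 - q) with hRq
  set V₁ := (2 * Real.Gamma (1 / q + 1)) ^ N / Real.Gamma (N / q + 1) with hV₁
  set D := |(Matrix.of b).det| with hD
  set L := Submodule.span ℤ (Set.range b) with hL
  have hq0 : 0 < q := by linarith
  have hNpos : (0 : ℝ) < N := by exact_mod_cast hN
  have hRqpos : 0 < Rq := by
    rw [hRq]; refine _root_.mul_pos ?_ ?_
    · apply Real.rpow_pos_of_pos; apply div_pos <;> linarith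
    · positivity
  have hV₁pos : 0 < V₁ := by
    rw [hV₁]
    apply div_pos
    · apply pow_pos; exact _root_.mul_pos two_pos (Real.Gamma_pos_of_pos (by positivity))
    · exact Real.Gamma_pos_of_pos (by positivity)
  have hρq : ρ ^ q < 1 := Real.rpow_lt_one hρ0.le hρ1 hq0
  set Bd := 2 / (ρ * Rq ^ (1 / q)) * (q * D / ((1 - ρ ^ q) * V₁)) ^ (1 / (N : ℝ)) with hBd
  have hBd0 : 0 ≤ Bd := by
    rw [hBd]; apply mul_nonneg (by positivity)
    apply Real.rpow_nonneg; apply div_nonneg (by positivity); nlinarith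
  -- key: any admissible `λ` is `≤ Bd`
  have hkey : ∀ lam : ℝ, 0 < lam → (∀ v ∈ L, v ≠ 0 → lam ≤ ∑ t, |v t|) → lam ≤ Bd := by
    intro lam hlam hmin
    exact lam_le_of_covolume_ineq hN hlam hρ0 hρq hRqpos hV₁pos
      (covolume_ineq b hq hN hlam hmin hρ0 hρ1)
  by_contra hcon
  push Not at hcon
  -- the finitely many non-zero lattice vectors of `ℓ₁`-norm `≤ Bd + 1`
  have hfin : ({v | v ∈ L ∧ v ≠ 0 ∧ ∑ t, |v t| ≤ Bd + 1} : Set (ι → ℝ)).Finite := by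
    have h1 : (Metric.closedBall (0 : ι → ℝ) (Bd + 1) ∩ (L : Set (ι → ℝ))).Finite :=
      ZSpan.setFinite_inter b Metric.isBounded_closedBall
    refine h1.subset ?_
    rintro v ⟨hvL, -, hv⟩
    refine ⟨?_, hvL⟩
    rw [Metric.mem_closedBall, dist_zero_right, pi_norm_le_iff_of_nonneg (by positivity)]
    intro t
    rw [Real.norm_eq_abs]
    exact (Finset.single_le_sum (f := fun t => |v t|) (fun t _ => abs_nonneg _)
      (Finset.mem_univ t)).trans hv
  set W := hfin.toFinset with hW
  rcases W.eq_empty_or_nonempty with hWe | hWne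
  · -- no short vectors at all: take `λ = Bd + 1`
    have := hkey (Bd + 1) (by positivity) (fun v hv hv0 => ?_)
    · linarith
    · by_contra hlt
      push Not at hlt
      have hmem : v ∈ W := hfin.mem_toFinset.mpr ⟨hv, hv0, hlt.le⟩
      rw [hWe] at hmem
      exact absurd hmem (Finset.notMem_empty _)
  · obtain ⟨v₀, hv₀W, hv₀min⟩ := W.exists_min_image (fun v => ∑ t, |v t|) hWne
    obtain ⟨hv₀L, hv₀0, hv₀le⟩ := hfin.mem_toFinset.mp hv₀W
    have hlamBd : Bd < ∑ t, |v₀ t| := hcon v₀ hv₀L hv₀0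
    have hlampos : 0 < ∑ t, |v₀ t| := lt_of_le_of_lt hBd0 hlamBd
    have := hkey (∑ t, |v₀ t|) hlampos (fun v hv hv0 => ?_)
    · linarith
    · rcases le_or_gt (∑ t, |v t|) (Bd + 1) with hle | hgt
      · exact hv₀min v (hfin.mem_toFinset.mpr ⟨hv, hv0, hle⟩)
      · linarith

end bound

end Literature.Algebra.EuclideanLattices.Rankin
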